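import Literature.Computability.Cryptography.QuantumTuringMachineHeadCentred
import Literature.Computability.Cryptography.QubitRegisterProofs
import Literature.Computability.Cryptography.QuantumCircuit
import HarnessLib

/-!
# Binary-coded registers: pushed amplitude vectors, extended gates, and the bridge to placed gates

Generic infrastructure for turning unitaries on ABSTRACT finite registers (products of finite types,
as the head-centred register `QTM.HC M N = Λ × (ZMod N → Γ) × Bool × Bool` of
`QuantumTuringMachineHeadCentred.lean`) into gates and states of the tree's QUBIT model
(`Cryptography.QReg n = Fin n → Bool`, `placeGate`, `QCircuit`; prelude Q1–Q2), following the
encoding conventions of Nishimura–Ozawa 2002, §4 (symbols of an arbitrary finite alphabet are binary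
strings via an injective code `e : Σ → {0,1}^λ`; a simulation is read through the code) and the proof
of their Thm. 4.3 (gates `G₁`, `G₂` "connected with cells `i₁, …, i_m`" of a register of binary-coded
cells):

* `pushVec ι v` — the amplitude vector on `{0,1}^W` of an abstract amplitude vector `v : X → ℂ` under
  an injective code `ι : X → {0,1}^W` (zero off the code); `pushVec_single`, `sum_pushVec` (Born
  probabilities of events are read off either side);
* `extendGate κ u` — a matrix `u` on a finite alphabet `A`, coded by `κ : A ↪ {0,1}^k`, extended by
  the identity on non-code words to a `k`-qubit gate; multiplicative, adjoint-compatible, unitary for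
  unitary `u` (`extendGate_mem_unitaryGroup`), an involution for involutive `u`
  (`extendGate_mul_self_of`, which makes inverse-closedness of the resulting gate sets trivial), with
  entries among those of `u` and `0, 1` (`extendGate_apply_mem`, for polynomial-time computability);
* **`placeGate_extendGate_mulVec_pushVec`** — the bridge: if the wires `e` of a placement carry
  exactly the `A`-component of `X ≃ A × B` (coded by `κ`) and the other wires exactly the
  `B`-component, then `placeGate e (extendGate κ u)` acts on coded vectors as the abstract placed gate
  `liftMat π u = u ⊗ 1` (`placeGate_eq_liftMat`: the tree's `placeGate` is `liftMat` along
  `splitWires`).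

Everything is proved; no named facts. Used by the circuit realisation of the head-centred QTM
simulation (`BQPQTM ⊆ BQP`, S04 of `QuantumComplexity/QuantumTuring.lean`).

## References

* H. Nishimura, M. Ozawa, Theoret. Comput. Sci. 276 (2002) 147–181 = arXiv:quant-ph/9906095
  [NishimuraOzawa2002], §4 (quantum circuits: "`(G_i, π_i)` … the wire of bit number `π_i(j)` is
  connected with the `j`-th pin of `G_i`"; encodings `e`, `d`, `e_t`) and the proof of Thm. 4.3.
* M. A. Nielsen, I. L. Chuang, *Quantum Computation and Quantum Information*, CUP 2010, §4.2–4.3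
  (placing gates on registers) [NielsenChuang2010].
-/

noncomputable section

namespace Literature.Computability.Cryptography

open Matrix
open scoped BigOperators ComplexConjugate

namespace QTM

/-! ### Push-forward of amplitude vectors along a code -/

section push

variable {X : Type*} [Fintype X] {W : ℕ}

/-- The amplitude vector of a coded register: `pushVec ι v` puts amplitude `v x` on the code word
`ι x ∈ {0,1}^W` and `0` on non-code words (Nishimura–Ozawa 2002, §4: configurations are fed to the
circuit through an injective binary encoding `e : Σ → {0,1}^λ`, decoded by `d` with `d ∘ e = id`).
[cite: NishimuraOzawa2002, §4 (encoding e_t)] -/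
def pushVec (ι : X → QReg W) (v : X → ℂ) : QReg W → ℂ := fun y => ∑ x, if ι x = y then v x else 0

/-- Components of a pushed vector (definitional). [folklore] -/
theorem pushVec_apply (ι : X → QReg W) (v : X → ℂ) (y : QReg W) :
    pushVec ι v y = ∑ x, if ι x = y then v x else 0 := rfl

/-- On code words the pushed vector has the original amplitude. [folklore] -/
theorem pushVec_apply_code {ι : X → QReg W} (hι : Function.Injective ι) (v : X → ℂ) (x : X) :
    pushVec ι v (ι x) = v x := by
  rw [pushVec_apply, Finset.sum_eq_single x]
  · rw [if_pos rfl]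
  · intro x' _ hx'
    rw [if_neg (fun h => hx' (hι h))]
  · intro h
    exact absurd (Finset.mem_univ _) h

/-- Off the code the pushed vector vanishes. [folklore] -/
theorem pushVec_apply_of_not_mem (ι : X → QReg W) (v : X → ℂ) {y : QReg W}
    (hy : y ∉ Set.range ι) : pushVec ι v y = 0 :=
  Finset.sum_eq_zero fun x _ => if_neg fun h => hy ⟨x, h⟩

/-- The push-forward of a basis vector is the basis vector of its code word. [folklore] -/
theorem pushVec_single [DecidableEq X] {ι : X → QReg W} (hι : Function.Injective ι) (x₀ : X) :
    pushVec ι (Pi.single x₀ 1) = Pi.single (ι x₀) 1 := by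
  ext y
  by_cases hy : y ∈ Set.range ι
  · obtain ⟨x, rfl⟩ := hy
    rw [pushVec_apply_code hι, Pi.single_apply, Pi.single_apply]
    by_cases h : x = x₀
    · subst h
      simp
    · rw [if_neg h, if_neg (fun h' => h (hι h'))]
  · rw [pushVec_apply_of_not_mem ι _ hy, Pi.single_apply, if_neg]
    rintro rfl
    exact hy ⟨x₀, rfl⟩

/-- Push-forward is additive. [folklore] -/
theorem pushVec_add (ι : X → QReg W) (v w : X → ℂ) : pushVec ι (v + w) = pushVec ι v + pushVec ι w := by
  ext y
  simp only [pushVec_apply, Pi.add_apply, ← Finset.sum_add_distrib]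
  exact Finset.sum_congr rfl fun x _ => by split_ifs <;> simp

/-- Push-forward is homogeneous. [folklore] -/
theorem pushVec_smul (ι : X → QReg W) (c : ℂ) (v : X → ℂ) : pushVec ι (c • v) = c • pushVec ι v := by
  ext y
  simp only [pushVec_apply, Pi.smul_apply, smul_eq_mul, Finset.mul_sum]
  exact Finset.sum_congr rfl fun x _ => by split_ifs <;> simp

/-- Observables vanishing at amplitude `0` have the same value on `v` and on its push-forward (used for
Born probabilities of coded events). [folklore] -/
theorem sum_pushVec {ι : X → QReg W} (hι : Function.Injective ι) (v : X → ℂ) (F : QReg W → ℂ → ℝ)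
    (hF : ∀ y, F y 0 = 0) : ∑ y, F y (pushVec ι v y) = ∑ x, F (ι x) (v x) := by
  classical
  rw [← Finset.sum_subset (Finset.subset_univ (Finset.univ.image ι))]
  · rw [Finset.sum_image fun x _ x' _ h => hι h]
    exact Finset.sum_congr rfl fun x _ => by rw [pushVec_apply_code hι]
  · intro y _ hy
    rw [pushVec_apply_of_not_mem ι v, hF]
    intro ⟨x, hx⟩
    exact hy (Finset.mem_image.2 ⟨x, Finset.mem_univ _, hx⟩)

end push

/-! ### Extending a gate on a coded alphabet to all of `QReg k` -/

section extend

variable {A : Type*} [Fintype A] {k : ℕ}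

/-- **A gate on a coded alphabet, extended to all bit patterns**: `extendGate κ u` acts as `u` on the
code words `κ(A) ⊆ {0,1}^k` and as the identity on the non-code words (block diagonal `u ⊕ 1`), so that
it is a genuine `k`-qubit gate, unitary when `u` is (`extendGate_mem_unitaryGroup`), with entries among
those of `u`, `0`, `1` (`extendGate_apply_mem`). This is the standard way to let a finite gate act on
binary-coded symbols of an arbitrary finite alphabet (Nishimura–Ozawa 2002, proof of Thm. 4.3: "`p, q, …`
denote binary strings representing elements of `Q`"; Yao 1993). [cite: NishimuraOzawa2002, Thm. 4.3 (proof)] -/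
def extendGate (κ : A → QReg k) (u : Matrix A A ℂ) : Matrix (QReg k) (QReg k) ℂ :=
  Matrix.of fun c c' =>
    (∑ a, ∑ a', if κ a = c ∧ κ a' = c' then u a a' else 0) +
      (if c = c' ∧ c ∉ Set.range κ then 1 else 0)

/-- Entries of an extended gate (definitional). [folklore] -/
theorem extendGate_apply (κ : A → QReg k) (u : Matrix A A ℂ) (c c' : QReg k) :
    extendGate κ u c c' = (∑ a, ∑ a', if κ a = c ∧ κ a' = c' then u a a' else 0) +
      (if c = c' ∧ c ∉ Set.range κ then 1 else 0) := rfl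

variable {κ : A → QReg k} (hκ : Function.Injective κ)
include hκ

/-- On code words the extended gate is `u`. [folklore] -/
theorem extendGate_code_code (u : Matrix A A ℂ) (a a' : A) : extendGate κ u (κ a) (κ a') = u a a' := by
  rw [extendGate_apply, if_neg (fun h => h.2 ⟨a, rfl⟩), add_zero, Finset.sum_eq_single a]
  · rw [Finset.sum_eq_single a']
    · rw [if_pos ⟨rfl, rfl⟩]
    · intro b _ hb
      rw [if_neg (fun h => hb (hκ h.2))]
    · intro h; exact absurd (Finset.mem_univ _) h
  · intro b _ hb
    exact Finset.sum_eq_zero fun b' _ => if_neg fun h => hb (hκ h.1)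
  · intro h; exact absurd (Finset.mem_univ _) h

omit hκ in
/-- Columns of non-code words are identity columns. [folklore] -/
theorem extendGate_of_not_mem_right (u : Matrix A A ℂ) (c : QReg k) {c' : QReg k}
    (hc' : c' ∉ Set.range κ) : extendGate κ u c c' = if c = c' then 1 else 0 := by
  rw [extendGate_apply, Finset.sum_eq_zero, zero_add]
  · by_cases h : c = c'
    · subst h
      rw [if_pos ⟨rfl, hc'⟩, if_pos rfl]
    · rw [if_neg (fun h' => h h'.1), if_neg h]
  · intro a _
    exact Finset.sum_eq_zero fun a' _ => if_neg fun h => hc' ⟨a', h.2⟩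

omit hκ in
/-- Rows of non-code words are identity rows. [folklore] -/
theorem extendGate_of_not_mem_left (u : Matrix A A ℂ) {c : QReg k} (hc : c ∉ Set.range κ)
    (c' : QReg k) : extendGate κ u c c' = if c = c' then 1 else 0 := by
  rw [extendGate_apply, Finset.sum_eq_zero, zero_add]
  · by_cases h : c = c'
    · rw [if_pos ⟨h, hc⟩, if_pos h]
    · rw [if_neg (fun h' => h h'.1), if_neg h]
  · intro a _
    exact Finset.sum_eq_zero fun a' _ => if_neg fun h => hc ⟨a, h.1⟩

omit hκ in
/-- Code rows vanish on non-code columns. [folklore] -/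
theorem extendGate_code_of_not_mem (u : Matrix A A ℂ) (a : A) {c' : QReg k} (hc' : c' ∉ Set.range κ) :
    extendGate κ u (κ a) c' = 0 := by
  rw [extendGate_of_not_mem_right u _ hc', if_neg]
  rintro rfl
  exact hc' ⟨a, rfl⟩

omit hκ in
/-- Non-code rows vanish on code columns. [folklore] -/
theorem extendGate_of_not_mem_code (u : Matrix A A ℂ) {c : QReg k} (hc : c ∉ Set.range κ) (a' : A) :
    extendGate κ u c (κ a') = 0 := by
  rw [extendGate_of_not_mem_left u hc, if_neg]
  rintro rfl
  exact hc ⟨a', rfl⟩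

/-- Extension is multiplicative (block diagonal `u ⊕ 1`). [folklore] -/
theorem extendGate_mul (u v : Matrix A A ℂ) :
    extendGate κ (u * v) = extendGate κ u * extendGate κ v := by
  classical
  ext c c'
  rw [mul_apply]
  set T : Finset (QReg k) := Finset.univ.filter (fun c'' : QReg k => c'' ∉ Set.range κ) with hT
  have hmemT : ∀ {c'' : QReg k}, c'' ∈ T ↔ c'' ∉ Set.range κ := fun {c''} => by
    rw [hT, Finset.mem_filter]
    exact ⟨fun h => h.2, fun h => ⟨Finset.mem_univ _, h⟩⟩
  -- split the summation over `c''` into codes and non-codes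
  have hsplit : ∑ c'', extendGate κ u c c'' * extendGate κ v c'' c' =
      (∑ a, extendGate κ u c (κ a) * extendGate κ v (κ a) c') +
        ∑ c'' ∈ T, extendGate κ u c c'' * extendGate κ v c'' c' := by
    rw [← Finset.sum_filter_add_sum_filter_not Finset.univ (fun c'' => c'' ∈ Set.range κ)]
    congr 1
    rw [show Finset.univ.filter (fun c'' : QReg k => c'' ∈ Set.range κ) = Finset.univ.image κ by
      ext c''; simp [Set.mem_range, eq_comm]]
    rw [Finset.sum_image fun x _ x' _ h => hκ h]
  rw [hsplit]
  by_cases hc : c ∈ Set.range κ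
  · obtain ⟨a, rfl⟩ := hc
    by_cases hc' : c' ∈ Set.range κ
    · obtain ⟨a', rfl⟩ := hc'
      rw [extendGate_code_code hκ, mul_apply, Finset.sum_eq_zero (s := T), add_zero]
      · exact Finset.sum_congr rfl fun b _ => by rw [extendGate_code_code hκ, extendGate_code_code hκ]
      · intro c'' hc''
        rw [extendGate_code_of_not_mem u a (hmemT.1 hc''), zero_mul]
    · rw [extendGate_code_of_not_mem _ a hc', Finset.sum_eq_zero, Finset.sum_eq_zero, add_zero]
      · intro c'' hc''
        rw [extendGate_code_of_not_mem u a (hmemT.1 hc''), zero_mul]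
      · intro b _
        rw [extendGate_code_of_not_mem v b hc', mul_zero]
  · rw [Finset.sum_eq_zero, zero_add]
    · by_cases hc' : c' ∈ Set.range κ
      · obtain ⟨a', rfl⟩ := hc'
        rw [extendGate_of_not_mem_code _ hc a', Finset.sum_eq_zero]
        intro c'' hc''
        rw [extendGate_of_not_mem_code v (hmemT.1 hc'') a', mul_zero]
      · rw [extendGate_of_not_mem_left _ hc, Finset.sum_eq_single c]
        · rw [extendGate_of_not_mem_left u hc, if_pos rfl, one_mul, extendGate_of_not_mem_left v hc]
        · intro c'' _ hne
          rw [extendGate_of_not_mem_left u hc, if_neg (Ne.symm hne), zero_mul]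
        · intro h
          exact absurd (hmemT.2 hc) h
    · intro b _
      rw [extendGate_of_not_mem_code u hc b, zero_mul]

/-- Extension of the identity is the identity. [folklore] -/
theorem extendGate_one [DecidableEq A] : extendGate κ (1 : Matrix A A ℂ) = 1 := by
  ext c c'
  by_cases hc' : c' ∈ Set.range κ
  · obtain ⟨a', rfl⟩ := hc'
    by_cases hc : c ∈ Set.range κ
    · obtain ⟨a, rfl⟩ := hc
      rw [extendGate_code_code hκ, one_apply, one_apply]
      by_cases h : a = a'
      · subst h
        simp
      · rw [if_neg h, if_neg (fun h' => h (hκ h'))]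
    · rw [extendGate_of_not_mem_code _ hc, one_apply, if_neg]
      rintro rfl
      exact hc ⟨a', rfl⟩
  · rw [extendGate_of_not_mem_right _ _ hc', one_apply]

omit hκ in
/-- Extension commutes with the adjoint. [folklore] -/
theorem extendGate_conjTranspose (u : Matrix A A ℂ) : (extendGate κ u)ᴴ = extendGate κ uᴴ := by
  ext c c'
  have h1st : star (∑ a, ∑ a', if κ a = c' ∧ κ a' = c then u a a' else (0 : ℂ)) =
      ∑ a, ∑ a', if κ a = c ∧ κ a' = c' then uᴴ a a' else 0 := by
    simp only [star_sum]
    rw [Finset.sum_comm]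
    refine Finset.sum_congr rfl fun a _ => Finset.sum_congr rfl fun a' _ => ?_
    rw [conjTranspose_apply]
    by_cases h : κ a' = c' ∧ κ a = c
    · rw [if_pos h, if_pos ⟨h.2, h.1⟩]
    · rw [if_neg h, if_neg (fun h' => h ⟨h'.2, h'.1⟩), star_zero]
  have h2nd : star (if c' = c ∧ c' ∉ Set.range κ then (1 : ℂ) else 0) =
      if c = c' ∧ c ∉ Set.range κ then 1 else 0 := by
    by_cases h : c' = c ∧ c' ∉ Set.range κ
    · rw [if_pos h, if_pos ⟨h.1.symm, h.1 ▸ h.2⟩, star_one]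
    · rw [if_neg h, if_neg (fun h' : c = c' ∧ c ∉ Set.range κ => h ⟨h'.1.symm, h'.1 ▸ h'.2⟩), star_zero]
  rw [conjTranspose_apply, extendGate_apply, extendGate_apply, star_add, h1st, h2nd]

/-- **The extension of a unitary is a unitary gate.** [folklore] -/
theorem extendGate_mem_unitaryGroup [DecidableEq A] {u : Matrix A A ℂ} (hu : u ∈ Matrix.unitaryGroup A ℂ) :
    extendGate κ u ∈ Matrix.unitaryGroup (QReg k) ℂ := by
  rw [Matrix.mem_unitaryGroup_iff, star_eq_conjTranspose] at hu ⊢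
  rw [extendGate_conjTranspose, ← extendGate_mul hκ, hu, extendGate_one hκ]

/-- The extension of an involution is an involution (so inverse-closedness of gate sets is for free). [folklore] -/
theorem extendGate_mul_self_of [DecidableEq A] {u : Matrix A A ℂ} (hu : u * u = 1) :
    extendGate κ u * extendGate κ u = 1 := by
  rw [← extendGate_mul hκ, hu, extendGate_one hκ]

omit hκ in
/-- Entries of an extended gate are entries of `u`, or `0`, or `1`. [folklore] -/
theorem extendGate_apply_mem (u : Matrix A A ℂ) (S : Set ℂ) (h0 : (0 : ℂ) ∈ S) (h1 : (1 : ℂ) ∈ S)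
    (hu : ∀ a a', u a a' ∈ S) (hκ : Function.Injective κ) (c c' : QReg k) : extendGate κ u c c' ∈ S := by
  by_cases hc' : c' ∈ Set.range κ
  · obtain ⟨a', rfl⟩ := hc'
    by_cases hc : c ∈ Set.range κ
    · obtain ⟨a, rfl⟩ := hc
      rw [extendGate_code_code hκ]
      exact hu _ _
    · rw [extendGate_of_not_mem_code _ hc]
      exact h0
  · rw [extendGate_of_not_mem_right _ _ hc']
    split_ifs
    exacts [h1, h0]

end extend

/-! ### The bridge: placed extended gates act on coded vectors as placed abstract gates -/

section bridge

variable {X A B : Type*} [Fintype X] [Fintype A] [Fintype B] [DecidableEq B] {k W : ℕ}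

/-- `placeGate` (the tree's gate placement, `QubitRegister.lean`) is `liftMat` along `splitWires`
(`placeGate_eq_reindex_kronecker_holds`). [folklore] -/
theorem placeGate_eq_liftMat (e : Fin k ↪ Fin W) (U : Matrix (QReg k) (QReg k) ℂ) :
    placeGate e U = liftMat (splitWires e) U :=
  placeGate_eq_reindex_kronecker_holds e U

omit [Fintype B] in
/-- **The bridge between abstract and binary registers.** Let `X ≃ A × B` be an abstract register
coded into `W` qubits by `ι`, and let the wires `e : Fin k ↪ Fin W` carry exactly the `A`-component,
coded by `κ` (`(ι x) ∘ e = κ (π x).1`), while the remaining wires carry exactly the `B`-component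
(coded by an injective `lam`). Then the placed extended gate acts on coded vectors as the abstract
placed gate: `placeGate e (extendGate κ u) · pushVec ι v = pushVec ι ((u ⊗ 1) v)`. This is the
formal content of "`G` is connected with cells `i₁, …, i_m`" acting on encoded configurations
(Nishimura–Ozawa 2002, proof of Thm. 4.3). [cite: NishimuraOzawa2002, Thm. 4.3 (proof)] -/
theorem placeGate_extendGate_mulVec_pushVec (π : X ≃ A × B) (e : Fin k ↪ Fin W)
    {ι : X → QReg W} {κ : A → QReg k} (hκ : Function.Injective κ)
    {lam : B → (((Set.range e)ᶜ : Set (Fin W)) → Bool)} (hlam : Function.Injective lam)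
    (hcompat : ∀ x, splitWires e (ι x) = (κ (π x).1, lam (π x).2))
    (u : Matrix A A ℂ) (v : X → ℂ) :
    placeGate e (extendGate κ u) *ᵥ pushVec ι v = pushVec ι (liftMat π u *ᵥ v) := by
  classical
  have hι : Function.Injective ι := by
    intro x x' h
    have h2 := hcompat x
    rw [h, hcompat x'] at h2
    simp only [Prod.mk.injEq] at h2
    exact π.injective (Prod.ext (hκ h2.1.symm) (hlam h2.2.symm))
  rw [placeGate_eq_liftMat]
  ext y
  -- expand the left-hand side
  have lhs : (liftMat (splitWires e) (extendGate κ u) *ᵥ pushVec ι v) y =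
      ∑ x, (if (splitWires e y).2 = lam (π x).2 then
        extendGate κ u (splitWires e y).1 (κ (π x).1) * v x else 0) := by
    have e1 : (liftMat (splitWires e) (extendGate κ u) *ᵥ pushVec ι v) y =
        ∑ y', liftMat (splitWires e) (extendGate κ u) y y' * pushVec ι v y' := rfl
    rw [e1]
    simp only [liftMat_apply, pushVec_apply, Finset.mul_sum, ite_mul, zero_mul]
    rw [Finset.sum_comm]
    refine Finset.sum_congr rfl fun x _ => ?_
    rw [Finset.sum_eq_single (ι x)]
    · simp only [if_true, hcompat x]
    · intro y' _ hy'
      rw [if_neg (Ne.symm hy')]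
      simp
    · intro h; exact absurd (Finset.mem_univ _) h
  rw [lhs]
  by_cases hy : y ∈ Set.range ι
  · obtain ⟨x₀, rfl⟩ := hy
    rw [pushVec_apply_code hι, hcompat x₀]
    have e2 : (liftMat π u *ᵥ v) x₀ = ∑ x, liftMat π u x₀ x * v x := rfl
    rw [e2]
    refine Finset.sum_congr rfl fun x _ => ?_
    simp only [hlam.eq_iff, extendGate_code_code hκ, liftMat_apply, ite_mul, zero_mul]
  · rw [pushVec_apply_of_not_mem ι _ hy]
    refine Finset.sum_eq_zero fun x _ => ?_
    split_ifs with h2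
    · by_cases h1 : (splitWires e y).1 ∈ Set.range κ
      · obtain ⟨a₁, ha₁⟩ := h1
        exfalso
        apply hy
        refine ⟨π.symm (a₁, (π x).2), ?_⟩
        apply (splitWires e).injective
        rw [hcompat, Equiv.apply_symm_apply, Prod.ext_iff]
        exact ⟨ha₁, h2.symm⟩
      · rw [extendGate_of_not_mem_code _ h1, zero_mul]
    · rfl

end bridge

end QTM

end Literature.Computability.Cryptography

end
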